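import Summits.QuantumFields.YangMills.Theorems.SwapVirialDeficitZeroModeSigmaFourSmallBallRatePerHub
import HarnessLib

/-!
# Exact zero-mode rung Z5 — toward the POWER RATE of the σ-twisted four-leader small ball, measure side VII-b: the choice of scales
# (free-hands support of ⟨stmt-QuantumFields-24197⟩; split with w3 g63: deterministic Taylor package ✓`…SmallBallTaylor`, measure side w2 g56)

In the per-hub bound ✓`volume_flipSet_le` (part VI) we take the moment `p = 1/16` (the hub tolerates `p < 1/12`), the ratio threshold
`R₀ = 3s^{−3/8}`, the axial cut `ε = s^{1/8}`; then the Markov threshold is `T = (R₀/3)²ε² = s^{−1/2}` (`T^{−p} = s^{1/32}`), the shell half-width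
`δ = 8sR₀² = 72s^{1/4}`, and every piece is `O(s^{1/32})`:
* §R the exponent bookkeeping (`rpow` identities and the monotonicity `s^a ≤ s^{1/32}` for `a ≥ 1/32`, `0 < s ≤ 1`);
* §S ★★★ `volume_flipSet_le_rpow` — for `0 < s ≤ 1`, `3s^{5/8} ≤ 1/4`, `72s^{1/4} ≤ r/2`, `r ≤ 1` and the limit event dominated a.e.:
  `vol³(flip set) ≤ s^{1/32}·Φ(a)` with `Φ(a)` an explicit combination of `blockB`, the moment block at `p = 1/16`, and `vol³(limSigma 1 A)`.
HONEST LABEL: finite-dimensional real analysis (plan-level zero-mode rung of a DRAFT line «sharp-sigma»); NOT the fixed-`L` sharp law, NOT ⟨24197⟩; the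
Yang–Mills mass gap is NOT proved; no summit is proved by a line.  Width seat ym-line-sfw-p2-w2 g56 (cell ym-idea-1, free hands; own crux ⟨22884⟩ blocked-on ⟨19935⟩),
`--supports stmt-QuantumFields-24197`.  THEOREMS ONLY, standard axioms, 0 `sorry`.  References: [cite: Luscher1983, §2]; [cite: Vanbaal2001]; [folklore].
-/

set_option autoImplicit false

noncomputable section

open MeasureTheory Quaternion Set Filter Topology
open scoped Quaternion ENNReal BigOperators
open Literature.MathematicalPhysics.QuantumLattice
open Literature.Analysis.Calculus (radialUnit radialUnit_def norm_radialUnit)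
open Summit.QuantumFields.YangMills.Theorems.SwapTwistDeficit.ToronLog
open Summit.QuantumFields.YangMills.Theorems.SwapVirialDeficit.ZeroModeGroup

attribute [local instance] Literature.Analysis.FluidPDE.Tao2016.quatMeasurableSpace
  Literature.Analysis.FluidPDE.Tao2016.quatBorelSpace

namespace Summit.QuantumFields.YangMills.Theorems.SwapVirialDeficit.ZeroModeSigma

/-! ## §R Exponent bookkeeping -/

/-- `s^a ≤ s^{1/32}` for `0 < s ≤ 1`, `1/32 ≤ a`. [folklore] -/
theorem rpow_le_rpow_rate {s a : ℝ} (hs : 0 < s) (hs1 : s ≤ 1) (ha : (1/32 : ℝ) ≤ a) : s ^ a ≤ s ^ (1/32 : ℝ) :=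
  Real.rpow_le_rpow_of_exponent_ge hs hs1 ha

/-- The Markov threshold: `((3s^{−3/8}/3)²·(s^{1/8})²)^{−1/16} = s^{1/32}`. [folklore] -/
theorem markov_threshold_rpow {s : ℝ} (hs : 0 < s) :
    ((3 * s ^ (-(3/8 : ℝ)) / 3) ^ 2 * (s ^ (1/8 : ℝ)) ^ 2) ^ (-(1/16 : ℝ)) = s ^ (1/32 : ℝ) := by
  have e1 : (3 * s ^ (-(3/8 : ℝ)) / 3) = s ^ (-(3/8 : ℝ)) := by field_simp
  rw [e1, ← Real.rpow_natCast (s ^ (-(3/8 : ℝ))) 2, ← Real.rpow_natCast (s ^ (1/8 : ℝ)) 2, ← Real.rpow_mul hs.le, ← Real.rpow_mul hs.le,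
    ← Real.rpow_add hs, ← Real.rpow_mul hs.le]
  norm_num

/-- The Markov threshold is positive and the ratio threshold squared is `s^{−3/4}`. [folklore] -/
theorem ratio_threshold_sq {s : ℝ} (hs : 0 < s) : (3 * s ^ (-(3/8 : ℝ)) / 3) ^ 2 = s ^ (-(3/4 : ℝ)) := by
  have e1 : (3 * s ^ (-(3/8 : ℝ)) / 3) = s ^ (-(3/8 : ℝ)) := by field_simp
  rw [e1, ← Real.rpow_natCast (s ^ (-(3/8 : ℝ))) 2, ← Real.rpow_mul hs.le]; norm_num

/-- The shell half-width: `8s(3s^{−3/8})² = 72s^{1/4}`. [folklore] -/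
theorem shell_width_rpow {s : ℝ} (hs : 0 < s) : 8 * s * (3 * s ^ (-(3/8 : ℝ))) ^ 2 = 72 * s ^ (1/4 : ℝ) := by
  rw [mul_pow, ← Real.rpow_natCast (s ^ (-(3/8 : ℝ))) 2, ← Real.rpow_mul hs.le]
  have e : s * s ^ (-(3/8 : ℝ) * (2:ℕ)) = s ^ (1/4 : ℝ) := by
    have h1 : s ^ (-(3/8 : ℝ) * (2:ℕ)) = s ^ (-(3/4 : ℝ)) := by norm_num
    rw [h1, show s * s ^ (-(3/4 : ℝ)) = s ^ (1:ℝ) * s ^ (-(3/4 : ℝ)) by rw [Real.rpow_one], ← Real.rpow_add hs]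
    norm_num
  calc 8 * s * ((3:ℝ) ^ 2 * s ^ (-(3/8 : ℝ) * (2:ℕ))) = 72 * (s * s ^ (-(3/8 : ℝ) * (2:ℕ))) := by ring
    _ = 72 * s ^ (1/4 : ℝ) := by rw [e]

/-- `s·R₀ = 3s^{5/8}`. [folklore] -/
theorem s_mul_ratio_threshold {s : ℝ} (hs : 0 < s) : s * (3 * s ^ (-(3/8 : ℝ))) = 3 * s ^ (5/8 : ℝ) := by
  have e : s * s ^ (-(3/8 : ℝ)) = s ^ (5/8 : ℝ) := by
    rw [show s * s ^ (-(3/8 : ℝ)) = s ^ (1:ℝ) * s ^ (-(3/8 : ℝ)) by rw [Real.rpow_one], ← Real.rpow_add hs]; norm_num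
  calc s * (3 * s ^ (-(3/8 : ℝ))) = 3 * (s * s ^ (-(3/8 : ℝ))) := by ring
    _ = _ := by rw [e]

/-- The axial cut and the layer weight: `s^{1/8} ≤ s^{1/32}` and `(s²)^{1/16} = s^{1/8}`. [folklore] -/
theorem layer_weight_rpow {s : ℝ} (hs : 0 < s) : (s ^ 2) ^ (1/16 : ℝ) = s ^ (1/8 : ℝ) := by
  rw [← Real.rpow_natCast s 2, ← Real.rpow_mul hs.le]; norm_num

/-- The slaved ratio cut: `2√(3/(R₀/3)²) ≤ 2√3·s^{1/32}` (`0 < s ≤ 1`). [folklore] -/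
theorem zRatio_cut_le {s : ℝ} (hs : 0 < s) (hs1 : s ≤ 1) :
    2 * Real.sqrt (3 / (3 * s ^ (-(3/8 : ℝ)) / 3) ^ 2) ≤ 2 * Real.sqrt 3 * s ^ (1/32 : ℝ) := by
  rw [ratio_threshold_sq hs, Real.rpow_neg hs.le, div_inv_eq_mul]
  have h1 : s ^ (3/4 : ℝ) ≤ s ^ (1/16 : ℝ) := Real.rpow_le_rpow_of_exponent_ge hs hs1 (by norm_num)
  have h2 : Real.sqrt (3 * s ^ (3/4 : ℝ)) ≤ Real.sqrt (3 * s ^ (1/16 : ℝ)) := Real.sqrt_le_sqrt (by nlinarith)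
  have h3 : Real.sqrt (3 * s ^ (1/16 : ℝ)) = Real.sqrt 3 * s ^ (1/32 : ℝ) := by
    rw [Real.sqrt_mul (by norm_num), Real.sqrt_eq_rpow (s ^ (1/16 : ℝ)), ← Real.rpow_mul hs.le]; norm_num
  nlinarith [h2, h3, Real.sqrt_nonneg (3 * s ^ (3/4 : ℝ))]

/-- The slaved layer: `2(3s²)^{1/2} ≤ 2√3·s^{1/32}` (`0 < s ≤ 1`). [folklore] -/
theorem zLayer_cut_le {s : ℝ} (hs : 0 < s) (hs1 : s ≤ 1) : 2 * (3 * s ^ 2) ^ (1/2 : ℝ) ≤ 2 * Real.sqrt 3 * s ^ (1/32 : ℝ) := by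
  rw [Real.mul_rpow (by norm_num) (sq_nonneg s), ← Real.sqrt_eq_rpow, ← Real.rpow_natCast s 2, ← Real.rpow_mul hs.le]
  have h1 : s ^ ((2:ℕ) * (1/2 : ℝ)) ≤ s ^ (1/32 : ℝ) := Real.rpow_le_rpow_of_exponent_ge hs hs1 (by norm_num)
  have h3 : 0 ≤ Real.sqrt 3 := Real.sqrt_nonneg 3
  nlinarith [mul_le_mul_of_nonneg_left h1 h3]

/-- The shell: `14δ(r+δ)⁶ ≤ 64512·s^{1/32}` for `δ = 72s^{1/4} ≤ 1/2`, `0 < r ≤ 1`, `0 < s ≤ 1`. [folklore] -/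
theorem shell_cut_le {r s : ℝ} (hs : 0 < s) (hs1 : s ≤ 1) (hr0 : 0 < r) (hr1 : r ≤ 1) (hδ : 72 * s ^ (1/4 : ℝ) ≤ 1 / 2) :
    14 * (8 * s * (3 * s ^ (-(3/8 : ℝ))) ^ 2) * (r + 8 * s * (3 * s ^ (-(3/8 : ℝ))) ^ 2) ^ 6 ≤ 64512 * s ^ (1/32 : ℝ) := by
  rw [shell_width_rpow hs]
  have hδ0 : 0 ≤ 72 * s ^ (1/4 : ℝ) := by positivity
  have h6 : (r + 72 * s ^ (1/4 : ℝ)) ^ 6 ≤ 2 ^ 6 := pow_le_pow_left₀ (by linarith) (by linarith) 6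
  have h1 : s ^ (1/4 : ℝ) ≤ s ^ (1/32 : ℝ) := Real.rpow_le_rpow_of_exponent_ge hs hs1 (by norm_num)
  have h0 : 0 ≤ (r + 72 * s ^ (1/4 : ℝ)) ^ 6 := by positivity
  calc 14 * (72 * s ^ (1/4 : ℝ)) * (r + 72 * s ^ (1/4 : ℝ)) ^ 6 ≤ 14 * (72 * s ^ (1/32 : ℝ)) * 2 ^ 6 := by
        gcongr
    _ = 64512 * s ^ (1/32 : ℝ) := by ring

/-! ## §S The per-hub bound at the chosen scales -/

/-- ★★★ **THE PER-HUB BOUND AT THE CHOSEN SCALES**: for `0 < s ≤ 1` with `3s^{5/8} ≤ 1/4`, `72s^{1/4} ≤ r/2`, `r ≤ 1`, at a hub with `a₀ ≠ 0`, `Im a ≠ 0`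
and the limit event dominated a.e., the flip set has `vol³ ≤ s^{1/32}·Φ(a)`, `Φ` explicit in `blockB`, the `p = 1/16` moment block and
`vol³(limSigma 1 A)`. [folklore] -/
theorem volume_flipSet_le_rpow {a : ℍ} (hre : a.re ≠ 0) (him : a.im ≠ 0) {r s : ℝ} (hs : 0 < s) (hs1 : s ≤ 1) (hr0 : 0 < r) (hr1 : r ≤ 1)
    (hR : 3 * s ^ (5/8 : ℝ) ≤ 1 / 4) (hδ : 72 * s ^ (1/4 : ℝ) ≤ r / 2)
    (hLdom : ∀ᵐ w ∂vol3, (limSigma r (radialUnit (axisPoint a))).indicator (1 : (ℍ × ℍ) × ℍ → ℝ≥0∞) w ≤ sigmaDom (radialUnit (axisPoint a)) w) :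
    vol3 ((rescaledSigmaR r s (radialUnit (axisPoint a)) \ limSigma r (radialUnit (axisPoint a))) ∪
        (limSigma r (radialUnit (axisPoint a)) \ rescaledSigmaR r s (radialUnit (axisPoint a)))) ≤
      ENNReal.ofReal (s ^ (1/32 : ℝ)) *
        (2 * (2 * (4 * (blockB (radialUnit (axisPoint a)).re (radialUnit (axisPoint a)).imI * (16 * ENNReal.ofReal (Real.exp 4)))) +
          2 * (4 * ((2 * (ENNReal.ofReal ((4 / ((radialUnit (axisPoint a)).re ^ 2 * (radialUnit (axisPoint a)).imI ^ 4)) ^ (1/16 : ℝ) * 2) *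
            blockB (radialUnit (axisPoint a)).re (radialUnit (axisPoint a)).imI)) * (16 * ENNReal.ofReal (Real.exp 4)))) +
          2 * (4 * ((2 * (ENNReal.ofReal ((4 / ((radialUnit (axisPoint a)).re ^ 2 * (radialUnit (axisPoint a)).imI ^ 4)) ^ (1/16 : ℝ) * 2) *
            blockB (radialUnit (axisPoint a)).re (radialUnit (axisPoint a)).imI)) * (16 * ENNReal.ofReal (Real.exp 4)))) +
          4 * blockB (radialUnit (axisPoint a)).re (radialUnit (axisPoint a)).imI * (ENNReal.ofReal (2 * Real.sqrt 3) * 8 * ENNReal.ofReal (Real.exp 4)) +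
          4 * blockB (radialUnit (axisPoint a)).re (radialUnit (axisPoint a)).imI * (ENNReal.ofReal (2 * Real.sqrt 3) * 8 * ENNReal.ofReal (Real.exp 4))) +
        65536 * vol3 (limSigma 1 (radialUnit (axisPoint a)))) := by
  -- parameters
  have hR0 : 0 < 3 * s ^ (-(3/8 : ℝ)) := by positivity
  have hε : 0 < s ^ (1/8 : ℝ) := by positivity
  have hsR : s * (3 * s ^ (-(3/8 : ℝ))) ≤ 1 / 4 := by rw [s_mul_ratio_threshold hs]; exact hR
  have hrs : r * s < 1 := by
    have h14 : s ^ (1/4 : ℝ) ≤ 1 / 144 := by nlinarith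
    have hs' : s ≤ s ^ (1/4 : ℝ) := by
      conv_lhs => rw [show s = s ^ (1:ℝ) from (Real.rpow_one s).symm]
      exact Real.rpow_le_rpow_of_exponent_ge hs hs1 (by norm_num)
    nlinarith
  have hδr : 8 * s * (3 * s ^ (-(3/8 : ℝ))) ^ 2 < r := by rw [shell_width_rpow hs]; linarith
  have hδ' : 72 * s ^ (1/4 : ℝ) ≤ 1 / 2 := by linarith
  have hmain := volume_flipSet_le hre him (p := 1/16) hs hr1 hrs hR0 hsR hε (by norm_num) (by norm_num) hδr hLdom
  refine hmain.trans ?_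
  -- abbreviations for the hub-dependent blocks
  set B := blockB (radialUnit (axisPoint a)).re (radialUnit (axisPoint a)).imI with hB
  set M := 2 * (ENNReal.ofReal ((4 / ((radialUnit (axisPoint a)).re ^ 2 * (radialUnit (axisPoint a)).imI ^ 4)) ^ (1/16 : ℝ) * 2) * B) with hM
  set E := (16 : ℝ≥0∞) * ENNReal.ofReal (Real.exp 4) with hE
  set V := vol3 (limSigma 1 (radialUnit (axisPoint a))) with hV
  set σ := ENNReal.ofReal (s ^ (1/32 : ℝ)) with hσ
  have hs32 : 0 ≤ s ^ (1/32 : ℝ) := by positivity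
  -- the five scalar comparisons
  have c1 : ENNReal.ofReal (4 * s ^ (1/8 : ℝ)) ≤ σ * 4 := by
    rw [hσ, ← ENNReal.ofReal_ofNat 4, ← ENNReal.ofReal_mul hs32]
    refine ENNReal.ofReal_le_ofReal ?_
    nlinarith [rpow_le_rpow_rate hs hs1 (by norm_num : (1/32 : ℝ) ≤ 1/8)]
  have c2 : ENNReal.ofReal (4 * ((3 * s ^ (-(3/8 : ℝ)) / 3) ^ 2 * (s ^ (1/8 : ℝ)) ^ 2) ^ (-(1/16 : ℝ))) = σ * 4 := by
    rw [markov_threshold_rpow hs, hσ, ← ENNReal.ofReal_ofNat 4, ← ENNReal.ofReal_mul hs32, mul_comm]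
  have c3 : ENNReal.ofReal (4 * (s ^ 2) ^ (1/16 : ℝ)) ≤ σ * 4 := by rw [layer_weight_rpow hs]; exact c1
  have c4 : ENNReal.ofReal (2 * Real.sqrt (3 / (3 * s ^ (-(3/8 : ℝ)) / 3) ^ 2)) ≤ σ * ENNReal.ofReal (2 * Real.sqrt 3) := by
    rw [hσ, ← ENNReal.ofReal_mul hs32]
    refine ENNReal.ofReal_le_ofReal ?_
    have := zRatio_cut_le hs hs1; linarith
  have c5 : ENNReal.ofReal (2 * (3 * s ^ 2) ^ (1/2 : ℝ)) ≤ σ * ENNReal.ofReal (2 * Real.sqrt 3) := by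
    rw [hσ, ← ENNReal.ofReal_mul hs32]
    refine ENNReal.ofReal_le_ofReal ?_
    have := zLayer_cut_le hs hs1; linarith
  have c6 : ENNReal.ofReal (14 * (8 * s * (3 * s ^ (-(3/8 : ℝ))) ^ 2) * (r + 8 * s * (3 * s ^ (-(3/8 : ℝ))) ^ 2) ^ 6) ≤ σ * 65536 := by
    rw [hσ, ← ENNReal.ofReal_ofNat 65536, ← ENNReal.ofReal_mul hs32]
    refine ENNReal.ofReal_le_ofReal ?_
    have := shell_cut_le hs hs1 hr0 hr1 hδ'
    nlinarith
  calc 2 * (2 * (ENNReal.ofReal (4 * s ^ (1/8 : ℝ)) * B * E) +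
        2 * (ENNReal.ofReal (4 * ((3 * s ^ (-(3/8 : ℝ)) / 3) ^ 2 * (s ^ (1/8 : ℝ)) ^ 2) ^ (-(1/16 : ℝ))) * M * E) +
        2 * (ENNReal.ofReal (4 * (s ^ 2) ^ (1/16 : ℝ)) * M * E) +
        4 * B * (ENNReal.ofReal (2 * Real.sqrt (3 / (3 * s ^ (-(3/8 : ℝ)) / 3) ^ 2)) * 8 * ENNReal.ofReal (Real.exp 4)) +
        4 * B * (ENNReal.ofReal (2 * (3 * s ^ 2) ^ (1/2 : ℝ)) * 8 * ENNReal.ofReal (Real.exp 4))) +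
        ENNReal.ofReal (14 * (8 * s * (3 * s ^ (-(3/8 : ℝ))) ^ 2) * (r + 8 * s * (3 * s ^ (-(3/8 : ℝ))) ^ 2) ^ 6) * V
      ≤ 2 * (2 * (σ * 4 * B * E) + 2 * (σ * 4 * M * E) + 2 * (σ * 4 * M * E) +
        4 * B * (σ * ENNReal.ofReal (2 * Real.sqrt 3) * 8 * ENNReal.ofReal (Real.exp 4)) +
        4 * B * (σ * ENNReal.ofReal (2 * Real.sqrt 3) * 8 * ENNReal.ofReal (Real.exp 4))) + σ * 65536 * V := by
        rw [c2]; gcongr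
    _ = σ * (2 * (2 * (4 * (B * E)) + 2 * (4 * (M * E)) + 2 * (4 * (M * E)) +
        4 * B * (ENNReal.ofReal (2 * Real.sqrt 3) * 8 * ENNReal.ofReal (Real.exp 4)) +
        4 * B * (ENNReal.ofReal (2 * Real.sqrt 3) * 8 * ENNReal.ofReal (Real.exp 4))) + 65536 * V) := by ring

end Summit.QuantumFields.YangMills.Theorems.SwapVirialDeficit.ZeroModeSigma

end
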